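/-
Copyright: cell pub-rosobs (carver-g58). INSTRUMENT for engine 1's W(f) toy model — NOT a resolution theorem.
-/
import Mathlib.Data.Rat.Lemmas
import Mathlib.Data.Finsupp.Basic
import Mathlib.Algebra.BigOperators.Group.Finset.Basic
import Mathlib.Algebra.Order.BigOperators.Group.Finset
import Mathlib.Algebra.Order.Field.Basic
import Mathlib.Algebra.Order.Field.Rat
import Mathlib.Tactic.Linarith
import Mathlib.Tactic.Ring
import Mathlib.Tactic.Push
import Mathlib.Tactic.FieldSimp
import HarnessLib

/-!
# The class menu at `p = 3` (LEMMA M3): pinned weights in `[¼, ½]` are `¼`, `⅓` or `½`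

INSTRUMENT, NOT a resolution theorem and NOT a statement about the Abramovich–Temkin–Włodarczyk invariant: this is the pure
weight arithmetic ("LEMMA M3", the class menu) that engine 1 of cell pub-rosobs uses in its `p = 3` boundary list for the `W(f)` TOY MODEL
(THEOREM-LT-eng1-g38 §13, THEOREM C3).  The engine's statement is typed as hypotheses → conclusion; nothing internally minted is cited as
a fact.  AI-written Lean; AI review is weaker than expert review.

Setting (as in `WeightedCentrePadicPin`): a slot set `N` with rational weights `w : N → ℚ`; a PIN of a slot `ε` is a value-`1` monomial
`μ : N →₀ ℕ` containing `ε` (`1 ≤ μ ε`, `Σ_s μ_s w_s = 1`) all of whose slots are at least as heavy as `ε` (`w ε ≤ w s` on the support) —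
the shape the cell's `(P)`-systems give to pins.  The standing upper bound is `w ≤ ½`.

* `not_weight_between_third_and_half` — a pinned slot has weight outside `(⅓, ½)`: its pin has `k = Σ μ_s` summands, each in `[w ε, ½]`,
  so `k/3 < 1 < k/2`, i.e. `2 < k < 3`.  (Valid for every `p`; only `w ≤ ½` is used.)
* `not_weight_between_quarter_and_third` — if moreover NO slot weighs in `(⅓, ½)`, a pinned slot has weight outside `(¼, ⅓)`: writing
  `k_A` for the multiplicity of weight-`½` slots in the pin and `k_B` for the rest (weights in `[w ε, ⅓]`), `k_A/2 + k_B/4 < 1 < k_A/2 + k_B/3`,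
  i.e. `2k_A + k_B < 4` and `6 < 3k_A + 2k_B` — no solution.
* `weight_menu_three` — LEMMA M3: all weights in `[¼, ½]` and every slot pinned ⇒ every weight is `¼`, `⅓` or `½`.

References: the weights/pins bookkeeping is that of weighted blow-ups [cite: AbramovichTemkinWlodarczyk2024, §5]; the lemma itself is
engine 1's (THEOREM-LT-eng1-g38 §13, LEMMA M3; machine cross-check `menu38.py` there), formalisation ours.
-/

namespace Literature.AlgebraicGeometry.Resolution.WeightedBlowup

namespace ClassMenu

open Finset

variable {N : Type*}

/-- A weighted sum `Σ_{s ∈ supp μ} μ_s · c` over a finitely supported `μ` is `(Σ μ_s) · c`. (bookkeeping)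
[cite: AbramovichTemkinWlodarczyk2024, §5] -/
theorem sum_cast_mul_const (μ : N →₀ ℕ) (c : ℚ) :
    ∑ s ∈ μ.support, (μ s : ℚ) * c = ((∑ s ∈ μ.support, μ s : ℕ) : ℚ) * c := by
  push_cast
  rw [Finset.sum_mul]

/-- **No pinned weight in `(⅓, ½)`** (engine 1, LEMMA M3 first half; valid for every `p`): if all weights are `≤ ½` and the slot `ε` has a
pin `μ` (value `1`, containing `ε`, other slots at least as heavy), then `¬ (⅓ < w ε < ½)`.  Proof: with `k = Σ μ_s` one gets
`k/3 < Σ μ_s w_s = 1 < k/2`. (engine statement typed as hypotheses → conclusion) [cite: AbramovichTemkinWlodarczyk2024, §5] -/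
theorem not_weight_between_third_and_half (w : N → ℚ) (hle : ∀ s, w s ≤ 1 / 2) {ε : N} (μ : N →₀ ℕ) (hμε : 1 ≤ μ ε)
    (hval : ∑ s ∈ μ.support, (μ s : ℚ) * w s = 1) (hheavy : ∀ s ∈ μ.support, w ε ≤ w s) :
    ¬ (1 / 3 < w ε ∧ w ε < 1 / 2) := by
  rintro ⟨h3, h2⟩
  have hε : ε ∈ μ.support := Finsupp.mem_support_iff.mpr (by omega)
  have hμε' : (0 : ℚ) < μ ε := by exact_mod_cast (show 0 < μ ε by omega)
  set k : ℕ := ∑ s ∈ μ.support, μ s with hk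
  have hlow : 0 < ∑ s ∈ μ.support, (μ s : ℚ) * (w s - 1 / 3) :=
    Finset.sum_pos' (fun s hs => mul_nonneg (Nat.cast_nonneg _) (by linarith [hheavy s hs]))
      ⟨ε, hε, mul_pos hμε' (by linarith)⟩
  have hup : 0 < ∑ s ∈ μ.support, (μ s : ℚ) * (1 / 2 - w s) :=
    Finset.sum_pos' (fun s hs => mul_nonneg (Nat.cast_nonneg _) (by linarith [hle s]))
      ⟨ε, hε, mul_pos hμε' (by linarith)⟩
  have e1 : ∑ s ∈ μ.support, (μ s : ℚ) * (w s - 1 / 3)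
      = (∑ s ∈ μ.support, (μ s : ℚ) * w s) - (k : ℚ) * (1 / 3) := by
    rw [hk, ← sum_cast_mul_const, ← Finset.sum_sub_distrib]
    exact Finset.sum_congr rfl fun s _ => by ring
  have e2 : ∑ s ∈ μ.support, (μ s : ℚ) * (1 / 2 - w s)
      = (k : ℚ) * (1 / 2) - ∑ s ∈ μ.support, (μ s : ℚ) * w s := by
    rw [hk, ← sum_cast_mul_const, ← Finset.sum_sub_distrib]
    exact Finset.sum_congr rfl fun s _ => by ring
  have hk3 : (k : ℚ) < 3 := by linarith
  have hk2 : (2 : ℚ) < k := by linarith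
  have hk3' : k < 3 := by exact_mod_cast hk3
  have hk2' : 2 < k := by exact_mod_cast hk2
  omega

/-- **No pinned weight in `(¼, ⅓)` once `(⅓, ½)` is empty** (engine 1, LEMMA M3 second half): if all weights are `≤ ½`, no slot weighs in
`(⅓, ½)`, and `ε` has a pin `μ` as above, then `¬ (¼ < w ε < ⅓)`.  Proof: the pin's slots weigh `½` (multiplicity `k_A`) or lie in `[w ε, ⅓]`
(multiplicity `k_B ≥ 1`), so `k_A/2 + k_B/4 < 1 < k_A/2 + k_B/3`; no naturals `k_A, k_B` satisfy `2k_A + k_B < 4 ∧ 6 < 3k_A + 2k_B`.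
(engine statement typed as hypotheses → conclusion) [cite: AbramovichTemkinWlodarczyk2024, §5] -/
theorem not_weight_between_quarter_and_third (w : N → ℚ) (hle : ∀ s, w s ≤ 1 / 2)
    (hgap : ∀ s, ¬ (1 / 3 < w s ∧ w s < 1 / 2)) {ε : N} (μ : N →₀ ℕ) (hμε : 1 ≤ μ ε)
    (hval : ∑ s ∈ μ.support, (μ s : ℚ) * w s = 1) (hheavy : ∀ s ∈ μ.support, w ε ≤ w s) :
    ¬ (1 / 4 < w ε ∧ w ε < 1 / 3) := by
  rintro ⟨h4, h3⟩
  have hε : ε ∈ μ.support := Finsupp.mem_support_iff.mpr (by omega)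
  have hμε' : (0 : ℚ) < μ ε := by exact_mod_cast (show 0 < μ ε by omega)
  have hεne : w ε ≠ 1 / 2 := ne_of_lt (by linarith)
  have hcase : ∀ s ∈ μ.support, w s ≠ 1 / 2 → w s ≤ 1 / 3 := by
    intro s _ hs
    by_contra h
    exact hgap s ⟨lt_of_not_ge h, lt_of_le_of_ne (hle s) hs⟩
  set kA : ℕ := ∑ s ∈ μ.support, (if w s = 1 / 2 then μ s else 0) with hkA
  set kB : ℕ := ∑ s ∈ μ.support, (if w s = 1 / 2 then 0 else μ s) with hkB
  have hlow : 0 < ∑ s ∈ μ.support, (if w s = 1 / 2 then (0 : ℚ) else (μ s : ℚ) * (w s - 1 / 4)) := by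
    refine Finset.sum_pos' (fun s hs => ?_) ⟨ε, hε, ?_⟩
    · split_ifs
      · exact le_rfl
      · exact mul_nonneg (Nat.cast_nonneg _) (by linarith [hheavy s hs])
    · rw [if_neg hεne]
      exact mul_pos hμε' (by linarith)
  have hup : 0 < ∑ s ∈ μ.support, (if w s = 1 / 2 then (0 : ℚ) else (μ s : ℚ) * (1 / 3 - w s)) := by
    refine Finset.sum_pos' (fun s hs => ?_) ⟨ε, hε, ?_⟩
    · split_ifs with h
      · exact le_rfl
      · exact mul_nonneg (Nat.cast_nonneg _) (by linarith [hcase s hs h])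
    · rw [if_neg hεne]
      exact mul_pos hμε' (by linarith)
  have e1 : ∑ s ∈ μ.support, (if w s = 1 / 2 then (0 : ℚ) else (μ s : ℚ) * (w s - 1 / 4))
      = (∑ s ∈ μ.support, (μ s : ℚ) * w s) - ((kA : ℚ) * (1 / 2) + (kB : ℚ) * (1 / 4)) := by
    rw [hkA, hkB]
    push_cast
    rw [Finset.sum_mul, Finset.sum_mul, ← Finset.sum_add_distrib, ← Finset.sum_sub_distrib]
    refine Finset.sum_congr rfl fun s _ => ?_
    split_ifs with h
    · rw [h]; ring
    · ring
  have e2 : ∑ s ∈ μ.support, (if w s = 1 / 2 then (0 : ℚ) else (μ s : ℚ) * (1 / 3 - w s))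
      = ((kA : ℚ) * (1 / 2) + (kB : ℚ) * (1 / 3)) - ∑ s ∈ μ.support, (μ s : ℚ) * w s := by
    rw [hkA, hkB]
    push_cast
    rw [Finset.sum_mul, Finset.sum_mul, ← Finset.sum_add_distrib, ← Finset.sum_sub_distrib]
    refine Finset.sum_congr rfl fun s _ => ?_
    split_ifs with h
    · rw [h]; ring
    · ring
  have i1 : (2 * kA + kB : ℚ) < 4 := by linarith
  have i2 : (6 : ℚ) < 3 * kA + 2 * kB := by linarith
  have i1' : 2 * kA + kB < 4 := by exact_mod_cast i1
  have i2' : 6 < 3 * kA + 2 * kB := by exact_mod_cast i2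
  omega

/-- **LEMMA M3 — the class menu at `p = 3`** (engine 1, THEOREM-LT §13): if every weight lies in `[¼, ½]` and every slot is pinned (value-`1`
monomial containing it, other slots at least as heavy — at threshold `< ¼` the cell's `(P)` pins every slot), then every weight is `¼`, `⅓`
or `½`. (engine statement typed as hypotheses → conclusion) [cite: AbramovichTemkinWlodarczyk2024, §5] -/
theorem weight_menu_three (w : N → ℚ) (hw : ∀ s, 1 / 4 ≤ w s ∧ w s ≤ 1 / 2)
    (pin : ∀ ε, ∃ μ : N →₀ ℕ, 1 ≤ μ ε ∧ (∑ s ∈ μ.support, (μ s : ℚ) * w s) = 1 ∧ ∀ s ∈ μ.support, w ε ≤ w s)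
    (ε : N) : w ε = 1 / 4 ∨ w ε = 1 / 3 ∨ w ε = 1 / 2 := by
  have hle : ∀ s, w s ≤ 1 / 2 := fun s => (hw s).2
  have hgap : ∀ s, ¬ (1 / 3 < w s ∧ w s < 1 / 2) := fun s => by
    obtain ⟨μ, h1, h2, h3⟩ := pin s
    exact not_weight_between_third_and_half w hle μ h1 h2 h3
  have hgap' : ¬ (1 / 4 < w ε ∧ w ε < 1 / 3) := by
    obtain ⟨μ, h1, h2, h3⟩ := pin ε
    exact not_weight_between_quarter_and_third w hle hgap μ h1 h2 h3
  obtain ⟨hlo, hhi⟩ := hw ε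
  by_cases h4 : w ε = 1 / 4
  · exact Or.inl h4
  by_cases h3 : w ε = 1 / 3
  · exact Or.inr (Or.inl h3)
  by_cases h2 : w ε = 1 / 2
  · exact Or.inr (Or.inr h2)
  exfalso
  rcases lt_or_gt_of_ne h3 with hlt | hgt
  · exact hgap' ⟨lt_of_le_of_ne hlo (Ne.symm h4), hlt⟩
  · exact hgap ε ⟨hgt, lt_of_le_of_ne hhi h2⟩

/-- The same menu under the cell's thresholded pin predicate (pins only for slots of weight `> η`, `η < ¼`). [cite: AbramovichTemkinWlodarczyk2024, §5] -/
theorem weight_menu_three_of_threshold (w : N → ℚ) (hw : ∀ s, 1 / 4 ≤ w s ∧ w s ≤ 1 / 2) {η : ℚ} (hη : η < 1 / 4)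
    (pin : ∀ ε, η < w ε → ∃ μ : N →₀ ℕ, 1 ≤ μ ε ∧ (∑ s ∈ μ.support, (μ s : ℚ) * w s) = 1 ∧ ∀ s ∈ μ.support, w ε ≤ w s)
    (ε : N) : w ε = 1 / 4 ∨ w ε = 1 / 3 ∨ w ε = 1 / 2 :=
  weight_menu_three w hw (fun s => pin s (by linarith [(hw s).1])) ε

end ClassMenu

end Literature.AlgebraicGeometry.Resolution.WeightedBlowup
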